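import Mathlib
import Literature.Analysis.FluidPDE.VectorCalculus
import Literature.Analysis.FluidPDE.VorticityCalculus
import Literature.Analysis.FluidPDE.SobolevWholeSpace
import Literature.Analysis.FluidPDE.TaoEnstrophyLocalisationProofs
import Literature.Analysis.FluidPDE.NSWeakStrongUniquenessProofs
import HarnessLib

/-!
# Efficiency ⇒ concentration, I: localisation tools
  (helper file for item stmt-NavierStokesRegularity-23111, `EfficiencyFloor.EfficiencyConcentration`)

Tools for the proof that an `ε`-efficient vortex-stretching production forces a `δ(ε)`-fraction of
the enstrophy into one ball of radius `∼ (Z/Pal)^{1/2}`: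

* scaled translated bumps `ψ_{R,a}(x) = χ(R⁻¹(x − a))` of a fixed `ContDiffBump χ` at `0`
  (smooth, `0 ≤ ψ ≤ 1`, `= 1` on `closedBall a (rIn R)`, `= 0` off `ball a (rOut R)`,
  `‖Dψ‖ ≤ L/R`);
* the localised vorticity `g = ψ_{R,a} • curl v` (`C¹`, compactly supported, `‖g‖ ≤ |curl v|`,
  `‖Dg‖ ≤ ‖D curl v‖ + (L/R)|curl v|` on `closedBall a (rOut R)` and `0` off it);
* its `L⁴` Gagliardo–Nirenberg bound `∫‖g‖⁴ ≤ K³ (∫‖g‖²)^{1/2} (∫‖Dg‖²)^{3/2}` (tree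
  `integral_norm_pow_four_le_of_integrable`);
* the Tonelli identity for ball indicators `∫_a ∫_x 1_{closedBall a r}(x) f(x) = |B_r| ∫ f` and the
  lower bound `|B_{rIn R}| ≤ ∫_a ψ_{R,a}(x)²` of the continuous partition of unity.

HONEST FRAMING: elementary real analysis on `ℝ³`; nothing here bears on Navier–Stokes regularity.

References: L. C. Evans, *Partial Differential Equations* (2010), §5.6.1 (Gagliardo–Nirenberg–Sobolev);
the localisation device is folklore.
-/

noncomputable section

set_option linter.dupNamespace false

namespace Summit.NavierStokesRegularity.NavierStokesRegularity.Theorems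

namespace EfficiencyConcentration

open MeasureTheory Metric Set Filter Topology Function
open scoped ENNReal NNReal RealInnerProductSpace
open Literature.Analysis.FluidPDE

/-! ### The scaled, translated bump -/

/-- A smooth compactly supported bump has a bounded derivative. [folklore] -/
theorem exists_bound_fderiv_bump (χ : ContDiffBump (0 : (EuclideanSpace ℝ (Fin 3)))) :
    ∃ L : ℝ, 0 ≤ L ∧ ∀ y, ‖fderiv ℝ (χ : (EuclideanSpace ℝ (Fin 3)) → ℝ) y‖ ≤ L := by
  have hc : Continuous (fderiv ℝ (χ : (EuclideanSpace ℝ (Fin 3)) → ℝ)) :=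
    (χ.contDiff (n := 1)).continuous_fderiv one_ne_zero
  obtain ⟨C, hC⟩ := (χ.hasCompactSupport.fderiv (𝕜 := ℝ)).exists_bound_of_continuous hc
  exact ⟨max C 0, le_max_right _ _, fun y => (hC y).trans (le_max_left _ _)⟩

/-- The scaled translated bump `x ↦ χ(R⁻¹(x − a))` is smooth. [folklore] -/
theorem contDiff_bump (χ : ContDiffBump (0 : (EuclideanSpace ℝ (Fin 3)))) (R : ℝ) (a : (EuclideanSpace ℝ (Fin 3))) {n : ℕ∞} :
    ContDiff ℝ n (fun x : (EuclideanSpace ℝ (Fin 3)) => (χ : (EuclideanSpace ℝ (Fin 3)) → ℝ) (R⁻¹ • (x - a))) :=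
  χ.contDiff.comp (by fun_prop)

/-- `0 ≤ χ(R⁻¹(x − a)) ≤ 1`. [folklore] -/
theorem bump_nonneg (χ : ContDiffBump (0 : (EuclideanSpace ℝ (Fin 3)))) (R : ℝ) (a x : (EuclideanSpace ℝ (Fin 3))) :
    0 ≤ (χ : (EuclideanSpace ℝ (Fin 3)) → ℝ) (R⁻¹ • (x - a)) := χ.nonneg

/-- `χ(R⁻¹(x − a)) ≤ 1`. [folklore] -/
theorem bump_le_one (χ : ContDiffBump (0 : (EuclideanSpace ℝ (Fin 3)))) (R : ℝ) (a x : (EuclideanSpace ℝ (Fin 3))) :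
    (χ : (EuclideanSpace ℝ (Fin 3)) → ℝ) (R⁻¹ • (x - a)) ≤ 1 := χ.le_one

/-- The scaled bump is `1` on `closedBall a (rIn R)`. [folklore] -/
theorem bump_eq_one (χ : ContDiffBump (0 : (EuclideanSpace ℝ (Fin 3)))) {R : ℝ} (hR : 0 < R) {a x : (EuclideanSpace ℝ (Fin 3))}
    (hx : x ∈ closedBall a (χ.rIn * R)) : (χ : (EuclideanSpace ℝ (Fin 3)) → ℝ) (R⁻¹ • (x - a)) = 1 := by
  apply χ.one_of_mem_closedBall
  rw [mem_closedBall, dist_zero_right, norm_smul, Real.norm_eq_abs, abs_of_pos (inv_pos.2 hR)]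
  rw [mem_closedBall, dist_eq_norm] at hx
  rw [inv_mul_le_iff₀ hR]
  linarith [mul_comm χ.rIn R]

/-- The scaled bump vanishes off `ball a (rOut R)`. [folklore] -/
theorem bump_eq_zero (χ : ContDiffBump (0 : (EuclideanSpace ℝ (Fin 3)))) {R : ℝ} (hR : 0 < R) {a x : (EuclideanSpace ℝ (Fin 3))}
    (hx : x ∉ ball a (χ.rOut * R)) : (χ : (EuclideanSpace ℝ (Fin 3)) → ℝ) (R⁻¹ • (x - a)) = 0 := by
  apply χ.zero_of_le_dist
  rw [dist_zero_right, norm_smul, Real.norm_eq_abs, abs_of_pos (inv_pos.2 hR)]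
  rw [mem_ball, dist_eq_norm, not_lt] at hx
  rw [le_inv_mul_iff₀ hR]
  linarith [mul_comm χ.rOut R]

/-- The support of the scaled bump lies in `closedBall a (rOut R)`. [folklore] -/
theorem tsupport_bump_subset (χ : ContDiffBump (0 : (EuclideanSpace ℝ (Fin 3)))) {R : ℝ} (hR : 0 < R) (a : (EuclideanSpace ℝ (Fin 3))) :
    tsupport (fun x : (EuclideanSpace ℝ (Fin 3)) => (χ : (EuclideanSpace ℝ (Fin 3)) → ℝ) (R⁻¹ • (x - a))) ⊆ closedBall a (χ.rOut * R) := by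
  refine closure_minimal (fun x hx => ?_) isClosed_closedBall
  by_contra h
  exact hx (bump_eq_zero χ hR fun h' => h (ball_subset_closedBall h'))

/-- Derivative of the scaled bump: `‖D[χ(R⁻¹(· − a))](x)‖ ≤ L/R` when `‖Dχ‖ ≤ L`. [folklore] -/
theorem norm_fderiv_bump_le (χ : ContDiffBump (0 : (EuclideanSpace ℝ (Fin 3)))) {R L : ℝ} (hR : 0 < R)
    (hL : ∀ y, ‖fderiv ℝ (χ : (EuclideanSpace ℝ (Fin 3)) → ℝ) y‖ ≤ L) (a x : (EuclideanSpace ℝ (Fin 3))) :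
    ‖fderiv ℝ (fun x : (EuclideanSpace ℝ (Fin 3)) => (χ : (EuclideanSpace ℝ (Fin 3)) → ℝ) (R⁻¹ • (x - a))) x‖ ≤ L / R := by
  have hL0 : 0 ≤ L := (norm_nonneg _).trans (hL 0)
  have hg : HasFDerivAt (fun x : (EuclideanSpace ℝ (Fin 3)) => R⁻¹ • (x - a)) (R⁻¹ • ContinuousLinearMap.id ℝ (EuclideanSpace ℝ (Fin 3))) x :=
    ((hasFDerivAt_id x).sub_const a).fun_const_smul R⁻¹
  have hχ : HasFDerivAt (χ : (EuclideanSpace ℝ (Fin 3)) → ℝ) (fderiv ℝ (χ : (EuclideanSpace ℝ (Fin 3)) → ℝ) (R⁻¹ • (x - a))) (R⁻¹ • (x - a)) :=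
    ((χ.contDiff (n := 1)).differentiable one_ne_zero _).hasFDerivAt
  have hcomp : HasFDerivAt ((χ : (EuclideanSpace ℝ (Fin 3)) → ℝ) ∘ fun x : (EuclideanSpace ℝ (Fin 3)) => R⁻¹ • (x - a))
      ((fderiv ℝ (χ : (EuclideanSpace ℝ (Fin 3)) → ℝ) (R⁻¹ • (x - a))).comp (R⁻¹ • ContinuousLinearMap.id ℝ (EuclideanSpace ℝ (Fin 3)))) x :=
    HasFDerivAt.comp x (g := (χ : (EuclideanSpace ℝ (Fin 3)) → ℝ)) hχ hg
  rw [show (fun x : (EuclideanSpace ℝ (Fin 3)) => (χ : (EuclideanSpace ℝ (Fin 3)) → ℝ) (R⁻¹ • (x - a))) =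
      ((χ : (EuclideanSpace ℝ (Fin 3)) → ℝ) ∘ fun x : (EuclideanSpace ℝ (Fin 3)) => R⁻¹ • (x - a)) from rfl, hcomp.fderiv]
  calc ‖(fderiv ℝ (χ : (EuclideanSpace ℝ (Fin 3)) → ℝ) (R⁻¹ • (x - a))).comp (R⁻¹ • ContinuousLinearMap.id ℝ (EuclideanSpace ℝ (Fin 3)))‖
      ≤ ‖fderiv ℝ (χ : (EuclideanSpace ℝ (Fin 3)) → ℝ) (R⁻¹ • (x - a))‖ * ‖R⁻¹ • ContinuousLinearMap.id ℝ (EuclideanSpace ℝ (Fin 3))‖ :=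
        ContinuousLinearMap.opNorm_comp_le _ _
    _ ≤ L * R⁻¹ := by
        refine mul_le_mul (hL _) ?_ (norm_nonneg _) hL0
        rw [norm_smul, Real.norm_eq_abs, abs_of_pos (inv_pos.2 hR)]
        exact mul_le_of_le_one_right (inv_pos.2 hR).le ContinuousLinearMap.norm_id_le
    _ = L / R := by rw [div_eq_mul_inv]

/-- Joint continuity of `(a, x) ↦ χ(R⁻¹(x − a))`. [folklore] -/
theorem continuous_bump_uncurry (χ : ContDiffBump (0 : (EuclideanSpace ℝ (Fin 3)))) (R : ℝ) :
    Continuous (fun p : (EuclideanSpace ℝ (Fin 3)) × (EuclideanSpace ℝ (Fin 3)) => (χ : (EuclideanSpace ℝ (Fin 3)) → ℝ) (R⁻¹ • (p.2 - p.1))) :=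
  χ.continuous.comp (by fun_prop)

/-! ### The localised vorticity `g = ψ • curl v` -/

section Loc

variable {v : (EuclideanSpace ℝ (Fin 3)) → (EuclideanSpace ℝ (Fin 3))}

/-- The localised vorticity is `C¹` when `curl v` is. [folklore] -/
theorem contDiff_loc (χ : ContDiffBump (0 : (EuclideanSpace ℝ (Fin 3)))) (R : ℝ) (a : (EuclideanSpace ℝ (Fin 3))) (hω : ContDiff ℝ 1 (curl v)) :
    ContDiff ℝ 1 (fun x : (EuclideanSpace ℝ (Fin 3)) => (χ : (EuclideanSpace ℝ (Fin 3)) → ℝ) (R⁻¹ • (x - a)) • curl v x) :=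
  (contDiff_bump χ R a).smul hω

/-- The localised vorticity is supported in `closedBall a (rOut R)`. [folklore] -/
theorem tsupport_loc_subset (χ : ContDiffBump (0 : (EuclideanSpace ℝ (Fin 3)))) {R : ℝ} (hR : 0 < R) (a : (EuclideanSpace ℝ (Fin 3))) :
    tsupport (fun x : (EuclideanSpace ℝ (Fin 3)) => (χ : (EuclideanSpace ℝ (Fin 3)) → ℝ) (R⁻¹ • (x - a)) • curl v x) ⊆
      closedBall a (χ.rOut * R) := by
  refine closure_minimal (fun x hx => ?_) isClosed_closedBall
  by_contra h
  exact hx (by simp [bump_eq_zero χ hR fun h' => h (ball_subset_closedBall h')])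

/-- The localised vorticity has compact support. [folklore] -/
theorem hasCompactSupport_loc (χ : ContDiffBump (0 : (EuclideanSpace ℝ (Fin 3)))) {R : ℝ} (hR : 0 < R) (a : (EuclideanSpace ℝ (Fin 3))) :
    HasCompactSupport (fun x : (EuclideanSpace ℝ (Fin 3)) => (χ : (EuclideanSpace ℝ (Fin 3)) → ℝ) (R⁻¹ • (x - a)) • curl v x) :=
  (isCompact_closedBall a (χ.rOut * R)).of_isClosed_subset isClosed_closure
    (tsupport_loc_subset χ hR a)

/-- `‖g x‖ ≤ |curl v x|`. [folklore] -/
theorem norm_loc_le (χ : ContDiffBump (0 : (EuclideanSpace ℝ (Fin 3)))) (R : ℝ) (a x : (EuclideanSpace ℝ (Fin 3))) :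
    ‖(χ : (EuclideanSpace ℝ (Fin 3)) → ℝ) (R⁻¹ • (x - a)) • curl v x‖ ≤ ‖curl v x‖ := by
  rw [norm_smul, Real.norm_eq_abs, abs_of_nonneg (bump_nonneg χ R a x)]
  exact mul_le_of_le_one_left (norm_nonneg _) (bump_le_one χ R a x)

/-- `‖g x‖² ≤ 1_{closedBall a (rOut R)}(x) |curl v x|²`. [folklore] -/
theorem norm_loc_sq_le_indicator (χ : ContDiffBump (0 : (EuclideanSpace ℝ (Fin 3)))) {R : ℝ} (hR : 0 < R) (a x : (EuclideanSpace ℝ (Fin 3))) :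
    ‖(χ : (EuclideanSpace ℝ (Fin 3)) → ℝ) (R⁻¹ • (x - a)) • curl v x‖ ^ 2 ≤
      (closedBall a (χ.rOut * R)).indicator (fun y => ‖curl v y‖ ^ 2) x := by
  by_cases hx : x ∈ closedBall a (χ.rOut * R)
  · rw [indicator_of_mem hx]
    exact pow_le_pow_left₀ (norm_nonneg _) (norm_loc_le χ R a x) 2
  · rw [indicator_of_notMem hx, bump_eq_zero χ hR fun h' => hx (ball_subset_closedBall h'),
      zero_smul, norm_zero]
    norm_num

/-- The derivative of the localised vorticity vanishes off `closedBall a (rOut R)`. [folklore] -/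
theorem fderiv_loc_eq_zero (χ : ContDiffBump (0 : (EuclideanSpace ℝ (Fin 3)))) {R : ℝ} (hR : 0 < R) {a x : (EuclideanSpace ℝ (Fin 3))}
    (hx : x ∉ closedBall a (χ.rOut * R)) :
    fderiv ℝ (fun x : (EuclideanSpace ℝ (Fin 3)) => (χ : (EuclideanSpace ℝ (Fin 3)) → ℝ) (R⁻¹ • (x - a)) • curl v x) x = 0 :=
  fderiv_of_notMem_tsupport ℝ fun h => hx (tsupport_loc_subset χ hR a h)

/-- Leibniz bound for the localised vorticity:
`‖Dg(x)‖ ≤ 1_{closedBall a (rOut R)}(x) (‖D curl v(x)‖ + (L/R)|curl v(x)|)`. [folklore] -/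
theorem norm_fderiv_loc_le (χ : ContDiffBump (0 : (EuclideanSpace ℝ (Fin 3)))) {R L : ℝ} (hR : 0 < R)
    (hL : ∀ y, ‖fderiv ℝ (χ : (EuclideanSpace ℝ (Fin 3)) → ℝ) y‖ ≤ L) (a x : (EuclideanSpace ℝ (Fin 3))) (hω : ContDiff ℝ 1 (curl v)) :
    ‖fderiv ℝ (fun x : (EuclideanSpace ℝ (Fin 3)) => (χ : (EuclideanSpace ℝ (Fin 3)) → ℝ) (R⁻¹ • (x - a)) • curl v x) x‖ ≤
      (closedBall a (χ.rOut * R)).indicator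
        (fun y => ‖fderiv ℝ (curl v) y‖ + L / R * ‖curl v y‖) x := by
  by_cases hx : x ∈ closedBall a (χ.rOut * R)
  · rw [indicator_of_mem hx]
    have hψ : DifferentiableAt ℝ (fun x : (EuclideanSpace ℝ (Fin 3)) => (χ : (EuclideanSpace ℝ (Fin 3)) → ℝ) (R⁻¹ • (x - a))) x :=
      (contDiff_bump χ R a (n := 1)).differentiable one_ne_zero x
    have hωx : DifferentiableAt ℝ (curl v) x := hω.differentiable one_ne_zero x
    rw [fderiv_fun_smul hψ hωx]
    calc ‖(χ : (EuclideanSpace ℝ (Fin 3)) → ℝ) (R⁻¹ • (x - a)) • fderiv ℝ (curl v) x +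
          (fderiv ℝ (fun x : (EuclideanSpace ℝ (Fin 3)) => (χ : (EuclideanSpace ℝ (Fin 3)) → ℝ) (R⁻¹ • (x - a))) x).smulRight (curl v x)‖
        ≤ ‖(χ : (EuclideanSpace ℝ (Fin 3)) → ℝ) (R⁻¹ • (x - a)) • fderiv ℝ (curl v) x‖ +
          ‖(fderiv ℝ (fun x : (EuclideanSpace ℝ (Fin 3)) => (χ : (EuclideanSpace ℝ (Fin 3)) → ℝ) (R⁻¹ • (x - a))) x).smulRight (curl v x)‖ :=
          norm_add_le _ _
      _ ≤ 1 * ‖fderiv ℝ (curl v) x‖ + L / R * ‖curl v x‖ := by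
          rw [norm_smul, Real.norm_eq_abs, abs_of_nonneg (bump_nonneg χ R a x),
            ContinuousLinearMap.norm_smulRight_apply]
          exact add_le_add (mul_le_mul_of_nonneg_right (bump_le_one χ R a x) (norm_nonneg _))
            (mul_le_mul_of_nonneg_right (norm_fderiv_bump_le χ hR hL a x) (norm_nonneg _))
      _ = ‖fderiv ℝ (curl v) x‖ + L / R * ‖curl v x‖ := by rw [one_mul]
  · rw [indicator_of_notMem hx, fderiv_loc_eq_zero χ hR hx, norm_zero]

/-- Squared Leibniz bound:
`‖Dg(x)‖² ≤ 1_{closedBall a (rOut R)}(x) · 2 (‖D curl v(x)‖² + (L/R)² |curl v(x)|²)`. [folklore] -/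
theorem norm_fderiv_loc_sq_le (χ : ContDiffBump (0 : (EuclideanSpace ℝ (Fin 3)))) {R L : ℝ} (hR : 0 < R)
    (hL : ∀ y, ‖fderiv ℝ (χ : (EuclideanSpace ℝ (Fin 3)) → ℝ) y‖ ≤ L) (a x : (EuclideanSpace ℝ (Fin 3))) (hω : ContDiff ℝ 1 (curl v)) :
    ‖fderiv ℝ (fun x : (EuclideanSpace ℝ (Fin 3)) => (χ : (EuclideanSpace ℝ (Fin 3)) → ℝ) (R⁻¹ • (x - a)) • curl v x) x‖ ^ 2 ≤
      (closedBall a (χ.rOut * R)).indicator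
        (fun y => 2 * (‖fderiv ℝ (curl v) y‖ ^ 2 + (L / R) ^ 2 * ‖curl v y‖ ^ 2)) x := by
  have h := norm_fderiv_loc_le χ hR hL a x hω
  by_cases hx : x ∈ closedBall a (χ.rOut * R)
  · rw [indicator_of_mem hx] at h ⊢
    have hL0 : 0 ≤ L := (norm_nonneg _).trans (hL 0)
    have hq : 0 ≤ L / R * ‖curl v x‖ := mul_nonneg (div_nonneg hL0 hR.le) (norm_nonneg _)
    calc ‖fderiv ℝ (fun x : (EuclideanSpace ℝ (Fin 3)) => (χ : (EuclideanSpace ℝ (Fin 3)) → ℝ) (R⁻¹ • (x - a)) • curl v x) x‖ ^ 2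
        ≤ (‖fderiv ℝ (curl v) x‖ + L / R * ‖curl v x‖) ^ 2 :=
          pow_le_pow_left₀ (norm_nonneg _) h 2
      _ ≤ 2 * (‖fderiv ℝ (curl v) x‖ ^ 2 + (L / R) ^ 2 * ‖curl v x‖ ^ 2) := by
          nlinarith [sq_nonneg (‖fderiv ℝ (curl v) x‖ - L / R * ‖curl v x‖)]
  · rw [indicator_of_notMem hx] at h ⊢
    have h0 : ‖fderiv ℝ (fun x : (EuclideanSpace ℝ (Fin 3)) => (χ : (EuclideanSpace ℝ (Fin 3)) → ℝ) (R⁻¹ • (x - a)) • curl v x) x‖ = 0 :=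
      le_antisymm h (norm_nonneg _)
    rw [h0]; norm_num

/-- **`L⁴` Gagliardo–Nirenberg bound for the localised vorticity**:
`∫‖g‖⁴ ≤ K³ (∫‖g‖²)^{1/2} (∫‖Dg‖²)^{3/2}`, `K` Mathlib's Sobolev constant (tree
`integral_norm_pow_four_le_of_integrable`; `g` is `C¹` with compact support).
[cite: Evans2010, §5.6.1 Thm. 1–2] -/
theorem integral_norm_loc_pow_four_le (χ : ContDiffBump (0 : (EuclideanSpace ℝ (Fin 3)))) {R : ℝ} (hR : 0 < R) (a : (EuclideanSpace ℝ (Fin 3)))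
    (hω : ContDiff ℝ 1 (curl v)) :
    ∫ x, ‖(χ : (EuclideanSpace ℝ (Fin 3)) → ℝ) (R⁻¹ • (x - a)) • curl v x‖ ^ 4 ≤
      (SNormLESNormFDerivOfEqConst (EuclideanSpace ℝ (Fin 3)) (volume : Measure (EuclideanSpace ℝ (Fin 3))) 2 : ℝ) ^ 3 *
        (∫ x, ‖(χ : (EuclideanSpace ℝ (Fin 3)) → ℝ) (R⁻¹ • (x - a)) • curl v x‖ ^ 2) ^ (1 / 2 : ℝ) *
        (∫ x, ‖fderiv ℝ (fun x : (EuclideanSpace ℝ (Fin 3)) => (χ : (EuclideanSpace ℝ (Fin 3)) → ℝ) (R⁻¹ • (x - a)) • curl v x) x‖ ^ 2) ^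
          (3 / 2 : ℝ) := by
  have hg := contDiff_loc χ R a hω
  have hgc := hasCompactSupport_loc (v := v) χ hR a
  have hcont : Continuous (fun x : (EuclideanSpace ℝ (Fin 3)) => (χ : (EuclideanSpace ℝ (Fin 3)) → ℝ) (R⁻¹ • (x - a)) • curl v x) := hg.continuous
  have hint : ∀ n : ℕ, n ≠ 0 →
      Integrable (fun x => ‖(χ : (EuclideanSpace ℝ (Fin 3)) → ℝ) (R⁻¹ • (x - a)) • curl v x‖ ^ n) := fun n hn =>
    ((hcont.norm).pow n).integrable_of_hasCompactSupport
      (hgc.norm.comp_left (g := fun r : ℝ => r ^ n) (zero_pow hn))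
  have hGc : HasCompactSupport
      (fderiv ℝ (fun x : (EuclideanSpace ℝ (Fin 3)) => (χ : (EuclideanSpace ℝ (Fin 3)) → ℝ) (R⁻¹ • (x - a)) • curl v x)) :=
    hgc.fderiv (𝕜 := ℝ)
  have hGcont : Continuous
      (fderiv ℝ (fun x : (EuclideanSpace ℝ (Fin 3)) => (χ : (EuclideanSpace ℝ (Fin 3)) → ℝ) (R⁻¹ • (x - a)) • curl v x)) :=
    hg.continuous_fderiv one_ne_zero
  have hGn : HasCompactSupport
      (fun x => ‖fderiv ℝ (fun x : (EuclideanSpace ℝ (Fin 3)) => (χ : (EuclideanSpace ℝ (Fin 3)) → ℝ) (R⁻¹ • (x - a)) • curl v x) x‖ ^ 2) :=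
    hGc.norm.comp_left (g := fun r : ℝ => r ^ 2) (zero_pow two_ne_zero)
  have hD : Integrable
      (fun x => ‖fderiv ℝ (fun x : (EuclideanSpace ℝ (Fin 3)) => (χ : (EuclideanSpace ℝ (Fin 3)) → ℝ) (R⁻¹ • (x - a)) • curl v x) x‖ ^ 2) :=
    (hGcont.norm.pow 2).integrable_of_hasCompactSupport hGn
  exact integral_norm_pow_four_le_of_integrable (volume : Measure (EuclideanSpace ℝ (Fin 3))) (F := (EuclideanSpace ℝ (Fin 3)))
    finrank_euclideanSpace_fin hg (hint 2 two_ne_zero) (hint 6 (by norm_num)) hD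

end Loc

/-! ### Tonelli for ball indicators and the continuous partition of unity -/

/-- **Tonelli for ball indicators**: `∫_a ∫_x 1_{closedBall a r}(x) f(x) = |closedBall 0 r| ∫ f`
(swap the integrals; `{a : x ∈ closedBall a r} = closedBall x r` has the volume of
`closedBall 0 r`). [folklore] -/
theorem lintegral_lintegral_indicator_closedBall {r : ℝ} (hr : 0 ≤ r) {f : (EuclideanSpace ℝ (Fin 3)) → ℝ≥0∞}
    (hf : Measurable f) :
    ∫⁻ a, ∫⁻ x, (closedBall a r).indicator f x =
      volume (closedBall (0 : (EuclideanSpace ℝ (Fin 3))) r) * ∫⁻ x, f x := by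
  set S : Set ((EuclideanSpace ℝ (Fin 3)) × (EuclideanSpace ℝ (Fin 3))) := {p | dist p.2 p.1 ≤ r} with hSdef
  have hS : MeasurableSet S :=
    (isClosed_le (continuous_snd.dist continuous_fst) continuous_const).measurableSet
  have hF : Measurable (fun p : (EuclideanSpace ℝ (Fin 3)) × (EuclideanSpace ℝ (Fin 3)) => S.indicator (fun p => f p.2) p) :=
    (hf.comp measurable_snd).indicator hS
  have h1 : ∀ a x, (closedBall a r).indicator f x = S.indicator (fun p => f p.2) (a, x) := by
    intro a x
    by_cases hx : x ∈ closedBall a r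
    · rw [indicator_of_mem hx, indicator_of_mem (by simpa [hSdef, mem_closedBall] using hx)]
    · rw [indicator_of_notMem hx, indicator_of_notMem (by simpa [hSdef, mem_closedBall] using hx)]
  simp_rw [h1]
  rw [lintegral_lintegral_swap hF.aemeasurable]
  have h2 : ∀ x, ∫⁻ a, S.indicator (fun p => f p.2) (a, x) = f x * volume (closedBall x r) := by
    intro x
    have h2' : ∀ a, S.indicator (fun p => f p.2) (a, x) =
        (closedBall x r).indicator (fun _ => f x) a := by
      intro a
      by_cases ha : a ∈ closedBall x r
      · rw [indicator_of_mem ha, indicator_of_mem]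
        simpa [hSdef, mem_closedBall, dist_comm] using ha
      · rw [indicator_of_notMem ha, indicator_of_notMem]
        simpa [hSdef, mem_closedBall, dist_comm] using ha
    simp_rw [h2']
    exact lintegral_indicator_const measurableSet_closedBall _
  simp_rw [h2]
  have h3 : ∀ x : (EuclideanSpace ℝ (Fin 3)), volume (closedBall x r) = volume (closedBall (0 : (EuclideanSpace ℝ (Fin 3))) r) := by
    intro x
    rw [Measure.addHaar_closedBall _ _ hr, Measure.addHaar_closedBall _ _ hr]
  simp_rw [h3]
  rw [lintegral_mul_const _ hf, mul_comm]

/-- **The continuous partition of unity from below**: for every `x`,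
`|closedBall 0 (rIn R)| ≤ ∫_a χ(R⁻¹(x − a))² da` (the integrand is `1` for
`a ∈ closedBall x (rIn R)`). [folklore] -/
theorem volume_closedBall_le_lintegral_bump_sq (χ : ContDiffBump (0 : (EuclideanSpace ℝ (Fin 3)))) {R : ℝ} (hR : 0 < R)
    (x : (EuclideanSpace ℝ (Fin 3))) :
    volume (closedBall (0 : (EuclideanSpace ℝ (Fin 3))) (χ.rIn * R)) ≤
      ∫⁻ a, ENNReal.ofReal ((χ : (EuclideanSpace ℝ (Fin 3)) → ℝ) (R⁻¹ • (x - a)) ^ 2) := by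
  have hr : 0 ≤ χ.rIn * R := (mul_pos χ.rIn_pos hR).le
  have h : EqOn (fun _ => (1 : ℝ≥0∞)) (fun a => ENNReal.ofReal ((χ : (EuclideanSpace ℝ (Fin 3)) → ℝ) (R⁻¹ • (x - a)) ^ 2))
      (closedBall x (χ.rIn * R)) := by
    intro a ha
    have hx : x ∈ closedBall a (χ.rIn * R) := by rwa [mem_closedBall, dist_comm] at ha
    simp [bump_eq_one χ hR hx]
  calc volume (closedBall (0 : (EuclideanSpace ℝ (Fin 3))) (χ.rIn * R))
      = volume (closedBall x (χ.rIn * R)) := by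
        rw [Measure.addHaar_closedBall _ _ hr, Measure.addHaar_closedBall _ _ hr]
    _ = ∫⁻ _ in closedBall x (χ.rIn * R), (1 : ℝ≥0∞) := (setLIntegral_one _).symm
    _ = ∫⁻ a in closedBall x (χ.rIn * R), ENNReal.ofReal ((χ : (EuclideanSpace ℝ (Fin 3)) → ℝ) (R⁻¹ • (x - a)) ^ 2) :=
        setLIntegral_congr_fun measurableSet_closedBall h
    _ ≤ ∫⁻ a, ENNReal.ofReal ((χ : (EuclideanSpace ℝ (Fin 3)) → ℝ) (R⁻¹ • (x - a)) ^ 2) := setLIntegral_le_lintegral _ _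

/-- Volume ratio of concentric balls: `|closedBall 0 (2s)| = 8 |closedBall 0 s|` in `(EuclideanSpace ℝ (Fin 3))`.
[folklore] -/
theorem volume_closedBall_two_mul {s : ℝ} (hs : 0 ≤ s) :
    volume (closedBall (0 : (EuclideanSpace ℝ (Fin 3))) (2 * s)) = 8 * volume (closedBall (0 : (EuclideanSpace ℝ (Fin 3))) s) := by
  rw [Measure.addHaar_closedBall _ _ (by positivity), Measure.addHaar_closedBall _ _ hs,
    finrank_euclideanSpace_fin, ← mul_assoc]
  congr 1
  rw [mul_pow, ENNReal.ofReal_mul (by positivity)]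
  norm_num

/-- The volume of a closed ball of positive radius in `(EuclideanSpace ℝ (Fin 3))` is positive and finite. [folklore] -/
theorem volume_closedBall_pos_lt_top {s : ℝ} (hs : 0 < s) :
    0 < volume (closedBall (0 : (EuclideanSpace ℝ (Fin 3))) s) ∧ volume (closedBall (0 : (EuclideanSpace ℝ (Fin 3))) s) < ⊤ :=
  ⟨measure_closedBall_pos _ _ hs, measure_closedBall_lt_top⟩

/-- Measurability in the centre of `a ↦ ∫_x 1_{closedBall a r}(x) f(x)`. [folklore] -/
theorem measurable_lintegral_indicator_closedBall (r : ℝ) {f : (EuclideanSpace ℝ (Fin 3)) → ℝ≥0∞} (hf : Measurable f) :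
    Measurable (fun a : (EuclideanSpace ℝ (Fin 3)) => ∫⁻ x, (closedBall a r).indicator f x) := by
  set S : Set ((EuclideanSpace ℝ (Fin 3)) × (EuclideanSpace ℝ (Fin 3))) := {p | dist p.2 p.1 ≤ r} with hSdef
  have hS : MeasurableSet S :=
    (isClosed_le (continuous_snd.dist continuous_fst) continuous_const).measurableSet
  have hF : Measurable (fun p : (EuclideanSpace ℝ (Fin 3)) × (EuclideanSpace ℝ (Fin 3)) => S.indicator (fun p => f p.2) p) :=
    (hf.comp measurable_snd).indicator hS
  have h1 : ∀ a x, (closedBall a r).indicator f x = S.indicator (fun p => f p.2) (a, x) := by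
    intro a x
    by_cases hx : x ∈ closedBall a r
    · rw [indicator_of_mem hx, indicator_of_mem (by simpa [hSdef, mem_closedBall] using hx)]
    · rw [indicator_of_notMem hx, indicator_of_notMem (by simpa [hSdef, mem_closedBall] using hx)]
  simp_rw [h1]
  exact hF.lintegral_prod_right'

/-- Measurability in the centre of `a ↦ ∫_x ‖χ(R⁻¹(x − a)) • curl v x‖ₑ⁴`. [folklore] -/
theorem measurable_lintegral_loc_pow_four (χ : ContDiffBump (0 : (EuclideanSpace ℝ (Fin 3)))) (R : ℝ)
    {v : (EuclideanSpace ℝ (Fin 3)) → (EuclideanSpace ℝ (Fin 3))} (hω : Continuous (curl v)) :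
    Measurable (fun a : (EuclideanSpace ℝ (Fin 3)) => ∫⁻ x, ‖(χ : (EuclideanSpace ℝ (Fin 3)) → ℝ) (R⁻¹ • (x - a)) • curl v x‖ₑ ^ 4) := by
  have hF : Measurable (fun p : (EuclideanSpace ℝ (Fin 3)) × (EuclideanSpace ℝ (Fin 3)) => ‖(χ : (EuclideanSpace ℝ (Fin 3)) → ℝ) (R⁻¹ • (p.2 - p.1)) • curl v p.2‖ₑ ^ 4) :=
    (((continuous_bump_uncurry χ R).smul (hω.comp continuous_snd)).measurable.enorm).pow_const _
  exact hF.lintegral_prod_right'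

end EfficiencyConcentration

end Summit.NavierStokesRegularity.NavierStokesRegularity.Theorems

end
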